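import Summits.QuantumFields.YangMills.Theorems.BalabanUVNodesK2V6Defs
import Summits.QuantumFields.YangMills.Theorems.BalabanUVNodesK2EndOfChain190OwnDrift
import Summits.QuantumFields.YangMills.Theorems.BalabanUVNodesN17RunRemAtOfShiftAnchorLevel

/-!
# Idea-5 g10 sketch — THE κ-FREE MODULUS HELPER ROAD for crux K2⁷ `EndpointGivenBR13SepCoPH` (stmt-QuantumFields-20543) AT PLAN g84's
# v7 CORNER KEYING (draft `K2Skeleton13SepCoPHv7c` 39189bf31904f7f3: 2ᶜᴰ `CornerDriftPos` :535, 1ᶜᴿ `RunChain190AtCornerDriftSlope` :549), typed EXACTLY in the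
# shape the plan asked for (bus l.30600 (5d) `EndpointGivenBR13SepCoPH_of_cornerDrift_runModulus`), kernel-checked, plus WHERE 1ᶜᴿ AND THE MODULUS TEXT MEET

Cell `ym-nodeO-ideate`, IDEATOR seat `ym-nodeO-idea-5` gen 10 (planner-ym-nodeO-idea-5-g10-0), lens «obstruction-first».  Crux workfile (count-neutral; nothing registered,
nothing filed under Theorems — the by-name Theorems twin is DEF-1's ∕ an4's lane: an4 g153 (O1) l.30587, plan g84 (5d) l.30600).  Companion of EDITION 3 of the crux idea card
`Ideas/two-bound-activity-interpolation.md`; answers CRIT-2 g3's ROUND-2 rider (`CRIT-2-ROUND2-two-bound-activity-interpolation.md` 578aae805dd2: «re-key by ONE paragraph, anchor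
hypothesis DELETED») and its price sheet §4 (`CRIT-2-PRICE-K2v7-beta3-ownnumbers.md` 178ee9c06415); kernel form of my word `WORD-v7-honesty-idea5g10.md` (cb94b66fa4ba) (H1)–(H3).
Supersedes the KEYING (not the engine `omegaMin`∕`tendsto_omegaMin`, not the interface `ActivityRepr`∕`LinOnRuns`∕`runModulus_of_linOnRuns`) of `Idea5g9TwoBoundSketch2.lean`
(628b3e3691ef) §1∕§4, whose v6 names (`ModulusAtAnchoredJets13`, `AnchorSurvSomeJets13`, κ, `θ.cβ · beta0OfJs F κ`) expire with v6 at the v7 registration.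

HONEST FRAMING.  Nothing here proves the Yang–Mills mass gap (Clay) or any rung of it.  Route R4 `BalabanUVNodes` closes only the CONDITIONAL finite-𝕋⁴ rung
`BalabanLadder.UV`; NODE O = [Balaban1987RG1] Thm 2 ∕ (0.31) p. 259 is UNPROVED in print; K2⁷ stays OPEN (v6 5a75a2378c79b303: 2 registered stubs, 0 closed; v7-corner = DRAFT in
its confirm window at the time of writing).  PROVED below: elementary real analysis and by-name bookkeeping into the crux decl.  DEFINED below: HYPOTHESIS SHAPES only — obligation
texts, none asserted, no instance at the record constructed.  The v7c draft is a desk file (not importable): its two texts are RE-DECLARED here VERBATIM (`CornerDriftPos13`,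
`RunChain190AtCornerDriftSlope13`; identity = byte comparison with :535–:562, nothing re-typed), so every road below re-targets the registered names by `Iff.rfl` once DEF-1's
`…K2V7Defs` mirror lands.

THE POINT (obstruction-first, (H3) of my word).  Under the corner keying the ANCHOR is no longer a card's hypothesis — it is an antecedent of the registered texts (`ScaleAnchor D.βfun b`,
`b` bound inside, unique by `ScaleAnchor.eq`).  So the modulus socket every 1ᴿ-side modulus supplier keys to (this card's S-LIN via Tannery; idea-2's peel; the κ3 convex-fibre card) is
ONE text with NO anchor hypothesis of its own, NO κ, NO `θ.cβ`: 1ᶜᴹ `RunModulusAtCornerDriftSlope13` = plan (5d)'s displayed shape VERBATIM.  The CAP of 1ᶜᴿ (`c.ε₁·K_rem,L ≤ s`, a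
smallness letter inside NODE O's text, chosen after θ and s — the located ∀θ bill (5b)) is PAID BY THE WINDOW on the modulus road: `ω(g) < s` for `g < u(s)`, so the constant-remainder
radius is `s` itself at some level `γ₁ ≤ γ₀`, and (C) moves down to `γ₁` by node N17's `survCont_anti` (p-landed `…N17RunRemAtOfShiftAnchorLevel` :81) — which is WHY (5d)'s shape may
carry `SurvCont D.βfun γ₀` at ONE level.  Both 1ᴿ-side texts factor through ONE consumed text 1ᶜᶜ `CapRemAtCornerDriftSlope13` («∃ window γ₀, ∃ radius r ≤ s, RunConstRemainder ∧ SurvCont»):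
1ᶜᴿ ⟹ 1ᶜᶜ with `r := c.ε₁·K_rem,L` (an4's `runConstRemainder_of_runLeaves190H`; = an4 g153 (W2) «consumer side = kernel fact» and plan (5c), here as a theorem on the v7c text), and
1ᶜᴹ ⟹ 1ᶜᶜ with `r := s`.  1ᶜᴿ and 1ᶜᴹ are INCOMPARABLE letters (constant `O(ε₁)` remainder on a fixed window vs remainder `→ 0` with the running coupling, uniformly in k — print's
(2.13) p. 268 «vanishes at g_k = 0» is the modulus SHAPE; its k-uniformity is NOT printed and is the card's S-LIN debt).

CONTENTS (0 `sorry`; no `instance`, `notation`, `axiom`):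
* §1 letters over `(β, b, γ₀)`: `RunModulus` (VERBATIM Sketch2 :114 = CRIT-2's probe :32), `runModulus_mono`, `runConstRemainder_of_runModulus`, ★ `endpointExistence_of_drift_runModulus_survContAt`
  (drift of `b`, slope `s > 0` + modulus rel. `b` on `]0, γ₀]` + (C) at the ONE level `γ₀` ⟹ `EndpointExistence`; tree END p596574 :156 + `survCont_anti`).
* §2 the corner keying: `CornerDriftPos13` (= v7c :535), `RunChain190AtCornerDriftSlope13` (= v7c :549), 1ᶜᴹ `RunModulusAtCornerDriftSlope13` (= plan (5d) verbatim), 1ᶜᴹ′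
  `RunModulusAtCorner13` (the drift-free cut: a modulus supplier needs neither the slope nor the drift; ⟹ 1ᶜᴹ), 1ᶜᶜ `CapRemAtCornerDriftSlope13`; roads `capRem13_of_runChain190` (1ᶜᴿ ⟹ 1ᶜᶜ),
  `capRem13_of_runModulus` (1ᶜᴹ ⟹ 1ᶜᶜ), ★★ `EndpointGivenBR13SepCoPH_of_cornerDriftPos_capRem` (2ᶜᴰ ∧ 1ᶜᶜ ⟹ crux decl BY NAME), ★★ `EndpointGivenBR13SepCoPH_of_cornerDrift_runModulus`
  (2ᶜᴰ ∧ 1ᶜᴹ ⟹ crux decl BY NAME — (5d)'s asked theorem, its name), ★★ `EndpointGivenBR13SepCoPH_of_cornerDrift_runModulusAtCorner` (2ᶜᴰ ∧ 1ᶜᴹ′ ⟹ crux), and the converse bookkeeping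
  `EndpointGivenBR13SepCoPH_of_cornerDriftKeyed13` (2ᶜᴰ ∧ 1ᶜᴿ ⟹ crux through 1ᶜᶜ — same conclusion as the draft's :564, by the other factorisation).
* §3 reserve dials (plan (5e) (b)∕(c)): the same modulus road with the base family `b` a PARAMETER (`DriftPosAt13 b`, `ModulusAt13 b`, ★★ `EndpointGivenBR13SepCoPH_of_driftPos_modulusAt`),
  so the fill-keyed pair (DEF-1 §3b ∕ p609486) and CRIT-2's R3 base line are served by instantiation if ever registered.
* §4 the card's OWN content re-keyed (edition 3): engine `omegaMin` ∕ `tendsto_omegaMin` ∕ `abs_tsum_le_omegaMin` and interface `LocDomainZ4` ∕ `ActivityRepr` ∕ `LinOnRuns` ∕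
  `runModulus_of_linOnRuns` VERBATIM from Sketch2 (crux workfiles are not importable); the corner-keyed record type `RecordReprCorner13` (D-REPR's type: NO κ, NO `θ.cβ`, NO anchor
  hypothesis of its own — the anchor is the `∀ b, ScaleAnchor … →` antecedent), `LinAtCorner13 𝓡` (S-LIN at the record), `SurvContSome13` ((C) at one level), `runModulusAtCorner13_of_lin_survCont`
  (S-LIN ∧ (C) ⟹ 1ᶜᴹ′, Tannery) and ★★★ `EndpointGivenBR13SepCoPH_of_cornerDrift_lin_survCont (𝓡) : CornerDriftPos13 → LinAtCorner13 𝓡 → SurvContSome13 → …EndpointGivenBR13SepCoPH`.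
* §5 the BOX edition (answers DEF-1 g6 bus l.30702 (i)): `BoxModulus`, `runModulus_of_boxModulus`, ★ `scaleAnchor_of_boxModulus` (box modulus ⟹ the corner limit), `BoxActivityRepr` ∕
  `LinOnBox` ∕ `boxModulus_of_linOnBox` (Tannery) ∕ ★ `scaleAnchor_of_linOnBox` (S-LIN-BOX supplies 2ᶜᴰ's EXISTENCE conjunct for the representation's own `b`), `BoxRecordRepr13` (D-REPR's
  type with the history-free part `N` a FIELD), `LinOnBox13`, `DriftAtN13` ((D1)'s sign at `N`), ★ `cornerDriftPos13_of_linOnBox_drift` (⟹ 2ᶜᴰ), ★ `runModulusAtCorner13_of_linOnBox_survCont`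
  (⟹ 1ᶜᴹ′ via `ScaleAnchor.eq`), ★★★★ `EndpointGivenBR13SepCoPH_of_linOnBox_drift_survCont (𝓑) : LinOnBox13 𝓑 → DriftAtN13 𝓑 → SurvContSome13 → …EndpointGivenBR13SepCoPH`.

Sources: [I] = [Balaban1987RG1] CMP 109 (1987) Thm 2 p. 259 (first sentence), Thm 3 p. 264, (1.20)–(1.22) p. 264, (2.12)–(2.14) p. 268, (5.10) p. 293, §1 pp. 263–264 ((C));
[II] = [Balaban1988RG2Cluster] CMP 116 (1988) Lemma 3 (2.38) p. 20, p. 8 L23–25; tree p596574 `…K2NamedJetsRunRemAt` (`RunConstRemainder`, `SurvCont`, END :156), p593586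
`…K2NamedJetsRemAt` (`ScaleAnchor`, `.eq`), p606097 `…K2EndOfChain190OwnDrift` + `…K2RunRemAtOfChain190` (`runConstRemainder_of_runLeaves190H`), p603331 `…K2V6Defs` (`Window13`),
`…N17RunRemAtOfShiftAnchorLevel` (ns `…BalabanUVNodes.N17RunRemAtOfShiftAnchorLevel`, `survCont_anti`), `Beta.Drift` (`OneLoopDrift`); desk draft `D84-K2V7/K2Skeleton13SepCoPHv7c.draft.lean` 39189bf31904f7f3 :535–:574; crux workfiles
`Idea5g9TwoBoundSketch2.lean`, `Crit2Idea5g8Probe.lean`.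
-/

noncomputable section

namespace Summit.QuantumFields.YangMills.Cruxes.EndpointGivenBR13SepCoPH.Idea5g10

open Filter Topology
open Literature.MathematicalPhysics.QuantumFieldTheory.Balaban1983to89
open Literature.MathematicalPhysics.QuantumFieldTheory.Balaban1983to89.FlowStep
open Literature.MathematicalPhysics.QuantumFieldTheory.Balaban1983to89.B13ScaleTransfer (Pt)
open Literature.MathematicalPhysics.QuantumFieldTheory.Balaban1983to89.DagBinding (EndpointExistence ForwardGenerated)
open Literature.MathematicalPhysics.QuantumFieldTheory.Balaban1983to89.T4Continuum (T4Family)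
open Literature.MathematicalPhysics.QuantumFieldTheory.Balaban1983to89.Beta.Drift (OneLoopDrift)
open Literature.MathematicalPhysics.QuantumFieldTheory.Balaban1983to89.B12Beta (HistBox)
open Literature.MathematicalPhysics.QuantumFieldTheory.Balaban1983to89.Beta.RemainderChainLattice
open Literature.MathematicalPhysics.QuantumFieldTheory.Balaban1983to89.Beta.RemainderLimitTorus (LDom limKernel)
open Literature.MathematicalPhysics.QuantumFieldTheory.Balaban1983to89.Beta.RemainderLocalityHolo
open Literature.MathematicalPhysics.QuantumFieldTheory.Balaban1983to89.Beta.RemainderDecay190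
open Literature.MathematicalPhysics.QuantumFieldTheory.Balaban1983to89.Beta.RemainderDecay190HoloChain
open Summit.QuantumFields.YangMills.Theorems.BalabanUVNodesK2NamedJetsRemAt (ScaleAnchor)
open Summit.QuantumFields.YangMills.Theorems.BalabanUVNodesK2NamedJetsRunRemAt (RunConstRemainder SurvCont
  endpointExistence_of_drift_runConstRemainder_survCont)
open Summit.QuantumFields.YangMills.Theorems.BalabanUVNodesK2RunRemAtOfChain190 (runConstRemainder_of_runLeaves190H)
open Summit.QuantumFields.YangMills.Theorems.BalabanUVNodesK2V6Defs (Window13)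
open Summit.QuantumFields.YangMills.BalabanUVNodes.N17RunRemAtOfShiftAnchorLevel (survCont_anti)

/-! ## §1 Letters (generic): the modulus letter VERBATIM; ★ drift + modulus + (C) at ONE level ⟹ `EndpointExistence` -/

/-- **`RunModulus β b γ₀` — the plain run-wise MODULUS letter**, VERBATIM `Idea5g9TwoBoundSketch2.lean` :114 = `Crit2Idea5g8Probe.lean` :32 (slot convention `k ≤ n` = the
tree's `RunConstRemainder`): ONE function `ω → 0` at `0⁺` bounds `|β_{k+1}(g_0,…,g_k) − b_k|` by `ω(g_k)` at every prefix of every in-window run of (0.20).  Hypothesis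
SHAPE; print's (2.13) «vanishes at g_k = 0» is its source, the uniformity in k is NOT printed. [cite: Balaban1987RG1, Thm 3 p.264 and (2.13) p.268] -/
def RunModulus (β : HBeta) (b : ℕ → ℝ) (γ₀ : ℝ) : Prop :=
  ∃ ω : ℝ → ℝ, Tendsto ω (𝓝[>] 0) (𝓝 0) ∧
    ∀ n gs, RGEqH n β gs → Step.InInterval γ₀ n gs → ∀ k, k ≤ n → |β k (prefixOf gs k) - b k| ≤ ω (gs k)

/-- The modulus letter restricts to lower levels. [folklore] -/
theorem runModulus_mono {β : HBeta} {b : ℕ → ℝ} {γ₀ γ₁ : ℝ} (h : RunModulus β b γ₀) (hle : γ₁ ≤ γ₀) : RunModulus β b γ₁ := by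
  obtain ⟨ω, hω, hrun⟩ := h
  exact ⟨ω, hω, fun n gs hrg hI k hk => hrun n gs hrg (fun j hj => ⟨(hI j hj).1, (hI j hj).2.trans hle⟩) k hk⟩

/-- **MODULUS ⟹ CONSTANT REMAINDER WITH ANY CAP** (verbatim Sketch2 :125): for EVERY `s > 0` there is a level `0 < γ₁ ≤ γ₀` with `RunConstRemainder β b s γ₁` — the cap
is paid by the WINDOW, not by a smallness letter. [folklore] -/
theorem runConstRemainder_of_runModulus {β : HBeta} {b : ℕ → ℝ} {γ₀ : ℝ} (h : RunModulus β b γ₀) (hγ₀ : 0 < γ₀) {s : ℝ}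
    (hs : 0 < s) : ∃ γ₁ : ℝ, 0 < γ₁ ∧ γ₁ ≤ γ₀ ∧ RunConstRemainder β b s γ₁ := by
  obtain ⟨ω, hω, hrun⟩ := h
  have hev : ∀ᶠ g in 𝓝[>] (0 : ℝ), ω g < s := (tendsto_order.1 hω).2 s hs
  obtain ⟨u, hu, hsub⟩ := mem_nhdsGT_iff_exists_Ioo_subset.1 hev
  have hu0 : (0 : ℝ) < u := hu
  refine ⟨min γ₀ (u / 2), lt_min hγ₀ (half_pos hu0), min_le_left _ _, ?_⟩
  intro n gs hrg hI k hk
  have hI₀ : Step.InInterval γ₀ n gs := fun j hj => ⟨(hI j hj).1, (hI j hj).2.trans (min_le_left _ _)⟩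
  have hmem : gs k ∈ Set.Ioo 0 u :=
    ⟨(hI k hk).1, lt_of_le_of_lt ((hI k hk).2.trans (min_le_right _ _)) (half_lt_self hu0)⟩
  have hlt : ω (gs k) < s := hsub hmem
  exact (hrun n gs hrg hI₀ k hk).trans hlt.le

/-- **MODULUS + (C) AT ONE LEVEL ⟹ THE CAP-KEYED LETTER PAIR at a smaller level** (the window pays the cap; (C) moves down by node N17's `survCont_anti`). [folklore] -/
theorem capRem_of_runModulus_survContAt {β : HBeta} {b : ℕ → ℝ} {γ₀ s : ℝ} (h : RunModulus β b γ₀) (hγ₀ : 0 < γ₀) (hs : 0 < s) (hsc : SurvCont β γ₀) :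
    ∃ γ₁ r : ℝ, 0 < γ₁ ∧ r ≤ s ∧ RunConstRemainder β b r γ₁ ∧ SurvCont β γ₁ := by
  obtain ⟨γ₁, hγ₁, hle, hrem⟩ := runConstRemainder_of_runModulus h hγ₀ hs
  exact ⟨γ₁, s, hγ₁, le_rfl, hrem, survCont_anti hγ₁ hle hsc⟩

/-- **★ DRIFT + MODULUS + (C) AT ONE LEVEL ⟹ `EndpointExistence`** (forward-generated constructions): a drift of `b` with slope `s > 0`, the modulus of `β` relative to the SAME `b` on
`]0, γ₀]` and survivor continuity at the level `γ₀` give [I] Thm 2's endpoint-existence half — cap `r := s` at some `0 < γ₁ ≤ γ₀` (`capRem_of_runModulus_survContAt`), then the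
tree's END `endpointExistence_of_drift_runConstRemainder_survCont` (p596574 :156).  No anchor used, no κ, no `θ.cβ`, no smallness letter.  CONDITIONAL bookkeeping; nothing of
Bałaban asserted. [cite: Balaban1987RG1, Thm 2 p.259 (first sentence), Thm 3 p.264, (2.13) p.268 and (5.10) p.293] -/
theorem endpointExistence_of_drift_runModulus_survContAt {β : HBeta} {C : B12.Construction} (hgen : ForwardGenerated C β) {b : ℕ → ℝ}
    {γ₀ s A : ℝ} (hγ₀ : 0 < γ₀) (hs : 0 < s) (hdrift : OneLoopDrift s A b) (hmod : RunModulus β b γ₀) (hsc : SurvCont β γ₀) :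
    EndpointExistence C := by
  obtain ⟨γ₁, r, hγ₁, hr, hrem, hsc₁⟩ := capRem_of_runModulus_survContAt hmod hγ₀ hs hsc
  exact endpointExistence_of_drift_runConstRemainder_survCont hgen hγ₁ hdrift hrem hr hsc₁

/-! ## §2 The v7 CORNER keying: the two draft texts VERBATIM, the modulus socket in plan (5d)'s shape, the consumed text 1ᶜᶜ, and the roads BY NAME -/

/-- **2ᶜᴰ `CornerDriftPos13` = v7c draft :535 `CornerDriftPos` VERBATIM (hypothesis shape; registered-to-be stub `stub_cornerDriftPos13`)**: under the crux prefix the record's β HAS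
in-box corner limits `b` (`ScaleAnchor`) drifting with SOME positive slope.  Re-declared only because the desk draft is not importable; never a fact. [cite: Balaban1987RG1, (1.3) p.260, (1.22) p.264 and (2.12)–(2.13) p.268] -/
def CornerDriftPos13 : Prop :=
  ∀ (F : T4Family) (θ : Node00.Stage13HParams F 2) (hP : θ.Provisos₁₃SepCoPH F 2), (θ.ZhUnity F 2 ∧ θ.SlotsNondegenerate₁₃ F 2) → θ.Admissible F 2 →
    B16.EndStatementBPrinted (Node00.datumOfRecord₁₃SepCoPH F 2 θ hP).C → Window13 F θ hP →
    ∃ (b : ℕ → ℝ) (s A : ℝ), ScaleAnchor (Node00.datumOfRecord₁₃SepCoPH F 2 θ hP).βfun b ∧ 0 < s ∧ OneLoopDrift s A b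

/-- **1ᶜᴿ `RunChain190AtCornerDriftSlope13` = v7c draft :549 `RunChain190AtCornerDriftSlope` VERBATIM (hypothesis shape; registered-to-be stub `stub_runChainCornerSlope13`)**: NODE O's wall
relative to the anchored corner numbers with the cap against the given slope.  Re-declared only because the desk draft is not importable; never a fact; size XL; instance 0∕1.
[cite: Balaban1987RG1, Thm 2 p.259 (first sentence), Thm 3 p.264, (2.12)–(2.14) p.268 and (5.10) p.293; Balaban1988RG2Cluster, Lemma 3 (2.38) p.20] -/
def RunChain190AtCornerDriftSlope13 : Prop :=
  ∀ (F : T4Family) (θ : Node00.Stage13HParams F 2) (hP : θ.Provisos₁₃SepCoPH F 2), (θ.ZhUnity F 2 ∧ θ.SlotsNondegenerate₁₃ F 2) → θ.Admissible F 2 →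
    B16.EndStatementBPrinted (Node00.datumOfRecord₁₃SepCoPH F 2 θ hP).C → Window13 F θ hP →
    ∀ (b : ℕ → ℝ) (s A : ℝ), ScaleAnchor (Node00.datumOfRecord₁₃SepCoPH F 2 θ hP).βfun b → 0 < s → OneLoopDrift s A b →
    ∃ (M : ℕ) (_ : NeZero M) (μ ν : Fin 4) (c : B13.Consts) (ℓ α₂ : ℝ) (q : Consts190) (γ₀ : ℝ),
      (∀ (n : ℕ) (gs : ℕ → ℝ), RGEqH n (Node00.datumOfRecord₁₃SepCoPH F 2 θ hP).βfun gs → Step.InInterval γ₀ n gs → ∀ k, k ≤ n →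
        ∃ a : LDom 4 → Pt 4 → ℝ, (Node00.datumOfRecord₁₃SepCoPH F 2 θ hP).βfun k (prefixOf gs k) - b k =
          B12Beta.secondMoment (fun _ _ => limKernel a) μ ν ∧ Nonempty (PolLeavesTFac190H 4 M a c ℓ α₂ q)) ∧
      CondsL 4 c ℓ ∧ c.R22gen ℓ ∧ q.Valid c.δ₀ ∧ SignsL c α₂ q.B₃ ∧ 0 < γ₀ ∧
      c.ε₁ * remCoeffL 4 M c α₂ q.B₃ ≤ s ∧ SurvCont (Node00.datumOfRecord₁₃SepCoPH F 2 θ hP).βfun γ₀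

/-- **1ᶜᴹ `RunModulusAtCornerDriftSlope13` — THE RE-KEYED MODULUS SOCKET, plan g84 (5d)'s displayed shape VERBATIM (hypothesis shape)**: «given ANY anchored, positively drifting corner
sequence `b`, the record's β has a run-wise MODULUS relative to `b` on some window `]0, γ₀]`, `γ₀ ≤ θ.γ`, with (C) at `γ₀`».  NO anchor hypothesis of its own (the anchor is the
text's antecedent), NO κ, NO `θ.cβ`.  THE one socket text the three modulus cards key to after v7 registers (CRIT-2 ROUND-2 rider; plan (5d)).  Never a fact. [cite: Balaban1987RG1, Thm 2 p.259 (first sentence) and (2.13) p.268] -/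
def RunModulusAtCornerDriftSlope13 : Prop :=
  ∀ (F : T4Family) (θ : Node00.Stage13HParams F 2) (hP : θ.Provisos₁₃SepCoPH F 2), (θ.ZhUnity F 2 ∧ θ.SlotsNondegenerate₁₃ F 2) → θ.Admissible F 2 →
    B16.EndStatementBPrinted (Node00.datumOfRecord₁₃SepCoPH F 2 θ hP).C → Window13 F θ hP →
    ∀ (b : ℕ → ℝ) (s A : ℝ), ScaleAnchor (Node00.datumOfRecord₁₃SepCoPH F 2 θ hP).βfun b → 0 < s → OneLoopDrift s A b →
    ∃ γ₀ : ℝ, 0 < γ₀ ∧ γ₀ ≤ θ.γ ∧ RunModulus (Node00.datumOfRecord₁₃SepCoPH F 2 θ hP).βfun b γ₀ ∧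
      SurvCont (Node00.datumOfRecord₁₃SepCoPH F 2 θ hP).βfun γ₀

/-- **1ᶜᴹ′ `RunModulusAtCorner13` — THE DRIFT-FREE CUT of the socket (hypothesis shape)**: a modulus supplier reads NEITHER the slope NOR the drift — «for any anchored corner sequence `b`,
a window with the modulus and (C)».  Implies 1ᶜᴹ (`runModulusAtCornerDriftSlope13_of_atCorner`); offered as the card-side statement (what S-LIN + Tannery actually produce).  Never a fact. [cite: Balaban1987RG1, (2.13) p.268] -/
def RunModulusAtCorner13 : Prop :=
  ∀ (F : T4Family) (θ : Node00.Stage13HParams F 2) (hP : θ.Provisos₁₃SepCoPH F 2), (θ.ZhUnity F 2 ∧ θ.SlotsNondegenerate₁₃ F 2) → θ.Admissible F 2 →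
    B16.EndStatementBPrinted (Node00.datumOfRecord₁₃SepCoPH F 2 θ hP).C → Window13 F θ hP →
    ∀ b : ℕ → ℝ, ScaleAnchor (Node00.datumOfRecord₁₃SepCoPH F 2 θ hP).βfun b →
    ∃ γ₀ : ℝ, 0 < γ₀ ∧ γ₀ ≤ θ.γ ∧ RunModulus (Node00.datumOfRecord₁₃SepCoPH F 2 θ hP).βfun b γ₀ ∧
      SurvCont (Node00.datumOfRecord₁₃SepCoPH F 2 θ hP).βfun γ₀

theorem runModulusAtCornerDriftSlope13_of_atCorner (h : RunModulusAtCorner13) : RunModulusAtCornerDriftSlope13 :=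
  fun F θ hP hU hθ hB hwin b _s _A hanch _hs _hd => h F θ hP hU hθ hB hwin b hanch

/-- **1ᶜᶜ `CapRemAtCornerDriftSlope13` — THE CONSUMED TEXT (hypothesis shape; WHAT THE END READS of either 1ᴿ-side supplier)**: «given any anchored, positively drifting corner sequence `b`
with slope `s`: SOME window `γ₀ > 0` and SOME radius `r ≤ s` with `RunConstRemainder β b r γ₀` and (C) at `γ₀`».  1ᶜᴿ ⟹ 1ᶜᶜ (`capRem13_of_runChain190`, `r := c.ε₁·K_rem,L`) and 1ᶜᴹ ⟹ 1ᶜᶜ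
(`capRem13_of_runModulus`, `r := s`).  Never a fact. [cite: Balaban1987RG1, Thm 2 p.259 (first sentence), (2.12)–(2.14) p.268 and (5.10) p.293] -/
def CapRemAtCornerDriftSlope13 : Prop :=
  ∀ (F : T4Family) (θ : Node00.Stage13HParams F 2) (hP : θ.Provisos₁₃SepCoPH F 2), (θ.ZhUnity F 2 ∧ θ.SlotsNondegenerate₁₃ F 2) → θ.Admissible F 2 →
    B16.EndStatementBPrinted (Node00.datumOfRecord₁₃SepCoPH F 2 θ hP).C → Window13 F θ hP →
    ∀ (b : ℕ → ℝ) (s A : ℝ), ScaleAnchor (Node00.datumOfRecord₁₃SepCoPH F 2 θ hP).βfun b → 0 < s → OneLoopDrift s A b →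
    ∃ γ₀ r : ℝ, 0 < γ₀ ∧ r ≤ s ∧ RunConstRemainder (Node00.datumOfRecord₁₃SepCoPH F 2 θ hP).βfun b r γ₀ ∧
      SurvCont (Node00.datumOfRecord₁₃SepCoPH F 2 θ hP).βfun γ₀

/-- **1ᶜᴿ ⟹ 1ᶜᶜ (proved): the draft's registered-to-be NODE-O text implies the consumed text** — the (190)-leaves give `RunConstRemainder` with radius `c.ε₁·K_rem,L` (an4's
`runConstRemainder_of_runLeaves190H`), the cap conjunct gives `r ≤ s`; `0 < γ₀` and (C) are conjuncts.  The display rows `(M, μ, ν, c, ℓ, α₂, q, a)` enter through the value bound only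
(an4 g153 (W2) ∕ plan (5c) «consumer side = kernel fact», here on the v7c text). [cite: Balaban1987RG1, (1.22) p.264 and (5.10) p.293; Balaban1988RG2Cluster, Lemma 3 (2.38) p.20] -/
theorem capRem13_of_runChain190 (h : RunChain190AtCornerDriftSlope13) : CapRemAtCornerDriftSlope13 := by
  intro F θ hP hU hθ hB hwin b s A hanch hs hd
  obtain ⟨M, iM, μ, ν, c, ℓ, α₂, q, γ₀, hrun, hC, h22, hq, hsg, hγ₀, hcap, hcont⟩ := h F θ hP hU hθ hB hwin b s A hanch hs hd
  exact ⟨γ₀, c.ε₁ * remCoeffL 4 M c α₂ q.B₃, hγ₀, hcap, runConstRemainder_of_runLeaves190H hrun hC h22 hq hsg (by norm_num), hcont⟩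

/-- **1ᶜᴹ ⟹ 1ᶜᶜ (proved): the modulus socket pays ANY cap by the window** (`capRem_of_runModulus_survContAt`, radius `s`, (C) moved down by `survCont_anti`).  The anchor and the drift
antecedents are passed through, not used. [folklore] -/
theorem capRem13_of_runModulus (h : RunModulusAtCornerDriftSlope13) : CapRemAtCornerDriftSlope13 := by
  intro F θ hP hU hθ hB hwin b s A hanch hs hd
  obtain ⟨γ₀, hγ₀, _hγθ, hmod, hsc⟩ := h F θ hP hU hθ hB hwin b s A hanch hs hd
  exact capRem_of_runModulus_survContAt hmod hγ₀ hs hsc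

/-- **★★ 2ᶜᴰ ∧ 1ᶜᶜ ⟹ THE CRUX DECL BY NAME** (`Summit.QuantumFields.YangMills.Theses.BalabanUVNodes.EndpointGivenBR13SepCoPH`): per tuple, the anchored drifting corner sequence from 2ᶜᴰ, the
window ∕ radius ∕ constant remainder ∕ (C) from 1ᶜᶜ at it, and the tree's END with the datum's forward generation `fwd`.  CONDITIONAL on the two displayed texts; K2⁷ NOT closed;
nothing of Bałaban asserted. [cite: Balaban1987RG1, Thm 2 p.259 (first sentence), Thm 3 p.264 and (5.10) p.293] -/
theorem EndpointGivenBR13SepCoPH_of_cornerDriftPos_capRem (h₁ : CornerDriftPos13) (h₂ : CapRemAtCornerDriftSlope13) :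
    Summit.QuantumFields.YangMills.Theses.BalabanUVNodes.EndpointGivenBR13SepCoPH := by
  intro F θ hP hU hθ hB hwin
  obtain ⟨b, s, A, hanch, hs, hd⟩ := h₁ F θ hP hU hθ hB hwin
  obtain ⟨γ₀, r, hγ₀, hr, hrem, hsc⟩ := h₂ F θ hP hU hθ hB hwin b s A hanch hs hd
  exact endpointExistence_of_drift_runConstRemainder_survCont (Node00.datumOfRecord₁₃SepCoPH F 2 θ hP).fwd hγ₀ hd hrem hr hsc

/-- **★★ THE κ-FREE MODULUS HELPER ROAD, plan g84 (5d)'s asked theorem (its name, its shape): 2ᶜᴰ ∧ 1ᶜᴹ ⟹ THE CRUX DECL BY NAME.**  So the three modulus cards (this card's ed.3, idea-2's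
`peel-two-threshold-modulus` ed.2, `convex-fibre-witten-modulus-kappa3` ed.2.3) re-key from `θ.cβ·beta0OfJs F κ` to the anchored corner `b` by DELETING their anchor hypothesis and stay wired
to the registered 2ᶜᴰ.  CONDITIONAL on the two displayed texts; K2⁷ NOT closed; nothing of Bałaban asserted. [cite: Balaban1987RG1, Thm 2 p.259 (first sentence), Thm 3 p.264, (2.13) p.268 and (5.10) p.293] -/
theorem EndpointGivenBR13SepCoPH_of_cornerDrift_runModulus (h₁ : CornerDriftPos13) (h₂ : RunModulusAtCornerDriftSlope13) :
    Summit.QuantumFields.YangMills.Theses.BalabanUVNodes.EndpointGivenBR13SepCoPH :=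
  EndpointGivenBR13SepCoPH_of_cornerDriftPos_capRem h₁ (capRem13_of_runModulus h₂)

/-- **★★ … and from the drift-free cut: 2ᶜᴰ ∧ 1ᶜᴹ′ ⟹ THE CRUX DECL BY NAME.**  CONDITIONAL; K2⁷ NOT closed. [cite: Balaban1987RG1, Thm 2 p.259 (first sentence) and (2.13) p.268] -/
theorem EndpointGivenBR13SepCoPH_of_cornerDrift_runModulusAtCorner (h₁ : CornerDriftPos13) (h₂ : RunModulusAtCorner13) :
    Summit.QuantumFields.YangMills.Theses.BalabanUVNodes.EndpointGivenBR13SepCoPH :=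
  EndpointGivenBR13SepCoPH_of_cornerDrift_runModulus h₁ (runModulusAtCornerDriftSlope13_of_atCorner h₂)

/-- **The draft's own composition, by the other factorisation (bookkeeping check)**: 2ᶜᴰ ∧ 1ᶜᴿ ⟹ the crux decl through 1ᶜᶜ — same statement as v7c :564
`EndpointGivenBR13SepCoPH_of_cornerDriftKeyed` (which goes through p606097 §2's one text); here END reads the chain only via `RunConstRemainder`. [cite: Balaban1987RG1, Thm 2 p.259 (first sentence), (1.22) p.264 and (5.10) p.293] -/
theorem EndpointGivenBR13SepCoPH_of_cornerDriftKeyed13 (h₁ : CornerDriftPos13) (h₂ : RunChain190AtCornerDriftSlope13) :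
    Summit.QuantumFields.YangMills.Theses.BalabanUVNodes.EndpointGivenBR13SepCoPH :=
  EndpointGivenBR13SepCoPH_of_cornerDriftPos_capRem h₁ (capRem13_of_runChain190 h₂)

/-- **THE SEAM IS RIGID (word (H1) in kernel form at the corner keying)**: at a tuple, two witnesses `(b, s)` and `(b′, s′)` of 2ᶜᴰ's body agree — the anchor pins `b` (`ScaleAnchor.eq`) and
the drift pins the slope (gaps cell's `oneLoopDrift_slope_unique`); so 1ᶜᴿ ∕ 1ᶜᴹ ∕ 1ᶜᶜ's `∀ b s` range over at most one pair per tuple. [folklore] -/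
theorem corner_and_slope_unique {β : HBeta} {b b' : ℕ → ℝ} {s s' A A' : ℝ} (hb : ScaleAnchor β b) (hb' : ScaleAnchor β b')
    (h : OneLoopDrift s A b) (h' : OneLoopDrift s' A' b') : b = b' ∧ s = s' := by
  obtain rfl : b = b' := hb.eq hb'
  exact ⟨rfl, Summit.QuantumFields.BalabanUV.Gaps.D1Residue.oneLoopDrift_slope_unique h h'⟩

/-! ## §3 Reserve dials (plan (5e) (b)∕(c)): the same road with the base family a PARAMETER -/

/-- The type of a BASE FAMILY (a reference sequence of one-loop numbers at every tuple; DEF-1's fill `bOwn F θ`, CRIT-2's R3 γ-base-line `limUnder` are instances). [folklore] -/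
abbrev BaseFamily : Type _ :=
  (F : T4Family) → (θ : Node00.Stage13HParams F 2) → θ.Provisos₁₃SepCoPH F 2 → ℕ → ℝ

/-- 2ᴰ[b] (hypothesis shape): the base numbers `b` drift with SOME positive slope, under the crux prefix (at DEF-1's fill `fun F θ _ => bOwn F θ` this is p610236's `OwnNumbersDriftPos` up to
`bOwn_eq_βfun_apply_zero`).  Never a fact. [cite: Balaban1987RG1, (1.3) p.260 and (2.12)–(2.14) p.268] -/
def DriftPosAt13 (b : BaseFamily) : Prop :=
  ∀ (F : T4Family) (θ : Node00.Stage13HParams F 2) (hP : θ.Provisos₁₃SepCoPH F 2), (θ.ZhUnity F 2 ∧ θ.SlotsNondegenerate₁₃ F 2) → θ.Admissible F 2 →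
    B16.EndStatementBPrinted (Node00.datumOfRecord₁₃SepCoPH F 2 θ hP).C → Window13 F θ hP →
    ∃ s A : ℝ, 0 < s ∧ OneLoopDrift s A (b F θ hP)

/-- 1ᴹ[b] (hypothesis shape): the modulus socket relative to the base `b` with (C) at its level, under the crux prefix.  Never a fact. [cite: Balaban1987RG1, Thm 2 p.259 (first sentence) and (2.13) p.268] -/
def ModulusAt13 (b : BaseFamily) : Prop :=
  ∀ (F : T4Family) (θ : Node00.Stage13HParams F 2) (hP : θ.Provisos₁₃SepCoPH F 2), (θ.ZhUnity F 2 ∧ θ.SlotsNondegenerate₁₃ F 2) → θ.Admissible F 2 →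
    B16.EndStatementBPrinted (Node00.datumOfRecord₁₃SepCoPH F 2 θ hP).C → Window13 F θ hP →
    ∃ γ₀ : ℝ, 0 < γ₀ ∧ γ₀ ≤ θ.γ ∧ RunModulus (Node00.datumOfRecord₁₃SepCoPH F 2 θ hP).βfun (b F θ hP) γ₀ ∧
      SurvCont (Node00.datumOfRecord₁₃SepCoPH F 2 θ hP).βfun γ₀

/-- **★★ base-parametric road: 2ᴰ[b] ∧ 1ᴹ[b] ⟹ THE CRUX DECL BY NAME** — serves the fill-keyed reserve pair (DEF-1 §3b ∕ p609486) and CRIT-2's R3 base line by instantiation, if ever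
registered.  CONDITIONAL; K2⁷ NOT closed. [cite: Balaban1987RG1, Thm 2 p.259 (first sentence) and (2.13) p.268] -/
theorem EndpointGivenBR13SepCoPH_of_driftPos_modulusAt (b : BaseFamily) (h₁ : DriftPosAt13 b) (h₂ : ModulusAt13 b) :
    Summit.QuantumFields.YangMills.Theses.BalabanUVNodes.EndpointGivenBR13SepCoPH := by
  intro F θ hP hU hθ hB hwin
  obtain ⟨s, A, hs, hd⟩ := h₁ F θ hP hU hθ hB hwin
  obtain ⟨γ₀, hγ₀, _hγθ, hmod, hsc⟩ := h₂ F θ hP hU hθ hB hwin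
  exact endpointExistence_of_drift_runModulus_survContAt (Node00.datumOfRecord₁₃SepCoPH F 2 θ hP).fwd hγ₀ hs hd hmod hsc

/-! ## §4 The card's OWN content re-keyed (edition 3): the Tannery engine and the pinned interface (VERBATIM Sketch2 §0∕§2), the corner-keyed record type with NO anchor
hypothesis of its own, S-LIN at the corner, and ★★★ 2ᶜᴰ ∧ S-LIN(𝓡) ∧ (C) ⟹ the crux decl BY NAME -/

section Engine

variable {ι : Type*}

/-- The two-bound interpolation modulus `ω(g) := Σ'_i min(A_i·g, M_i)` (verbatim Sketch2 :68). [folklore] -/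
def omegaMin (A M : ι → ℝ) (g : ℝ) : ℝ := ∑' i, min (A i * g) (M i)

theorem min_nonneg_of {A M : ι → ℝ} (hA : ∀ i, 0 ≤ A i) (hM : ∀ i, 0 ≤ M i) {g : ℝ} (hg : 0 ≤ g) (i : ι) :
    0 ≤ min (A i * g) (M i) :=
  le_min (mul_nonneg (hA i) hg) (hM i)

/-- **THE ENGINE (Tannery): `ω(g) → 0` as `g → 0⁺`** — summable frozen majorants + termwise vanishing, NO rate and NO summability asked of the vanishing constants `A_i`
(verbatim Sketch2 :76; Mathlib `tendsto_tsum_of_dominated_convergence`). [folklore] -/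
theorem tendsto_omegaMin {A M : ι → ℝ} (hA : ∀ i, 0 ≤ A i) (hM : ∀ i, 0 ≤ M i) (hsum : Summable M) :
    Tendsto (omegaMin A M) (𝓝[>] 0) (𝓝 0) := by
  have hlim : ∀ i, Tendsto (fun g : ℝ => min (A i * g) (M i)) (𝓝[>] 0) (𝓝 (min (A i * 0) (M i))) := by
    intro i
    have hc : Continuous fun g : ℝ => min (A i * g) (M i) :=
      (continuous_const.mul continuous_id).min continuous_const
    exact (hc.tendsto 0).mono_left nhdsWithin_le_nhds
  have hbd : ∀ᶠ g in 𝓝[>] (0 : ℝ), ∀ i, ‖min (A i * g) (M i)‖ ≤ M i := by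
    filter_upwards [self_mem_nhdsWithin] with g hg
    intro i
    rw [Real.norm_eq_abs, abs_of_nonneg (min_nonneg_of hA hM (le_of_lt hg) i)]
    exact min_le_right _ _
  have h := tendsto_tsum_of_dominated_convergence hsum hlim hbd
  have h0 : (fun i => min (A i * 0) (M i)) = fun _ => (0 : ℝ) := by
    funext i
    rw [mul_zero]
    exact min_eq_left (hM i)
  rw [h0, tsum_zero] at h
  exact h

/-- **THE TERMWISE-TO-SUM STEP** (verbatim Sketch2 :97): a convergent sum whose terms obey BOTH bounds is bounded by `ω`. [folklore] -/
theorem abs_tsum_le_omegaMin {A M : ι → ℝ} {I : ι → ℝ} {g : ℝ} (hsum : Summable M)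
    (hIM : ∀ i, |I i| ≤ M i) (hIA : ∀ i, |I i| ≤ A i * g) : |∑' i, I i| ≤ omegaMin A M g := by
  have hIs : Summable (fun i => |I i|) := hsum.of_nonneg_of_le (fun i => abs_nonneg _) hIM
  have hIn : Summable (fun i => ‖I i‖) := by simpa [Real.norm_eq_abs] using hIs
  have hmin : Summable (fun i => min (A i * g) (M i)) :=
    hsum.of_nonneg_of_le (fun i => (abs_nonneg _).trans (le_min (hIA i) (hIM i))) (fun i => min_le_right _ _)
  calc |∑' i, I i| = ‖∑' i, I i‖ := (Real.norm_eq_abs _).symm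
    _ ≤ ∑' i, ‖I i‖ := norm_tsum_le_tsum_norm hIn
    _ = ∑' i, |I i| := by simp [Real.norm_eq_abs]
    _ ≤ omegaMin A M g := hIs.tsum_le_tsum (fun i => le_min (hIA i) (hIM i)) hmin

end Engine

/-- **The index (CF4, unchanged): unit-lattice localization domains of ℤ⁴** after the limit T ↗ ℤ⁴ ([I] (5.1) p. 292), k- and volume-FREE, countable: Tannery-ready. [cite: Balaban1987RG1, (1.7) p.261 and (5.1) p.292] -/
abbrev LocDomainZ4 : Type := Finset (Fin 4 → ℤ)

/-- **`ActivityRepr β b γ₀` — a PINNED activity representation of the remainder (interface; VERBATIM Sketch2 :230; D-REPR's fibre).**  Along every in-window run, at every prefix,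
`β_{k+1}(g_0,…,g_k) − b_k = Σ_X I X k (g_0,…,g_k)` (`HasSum` over `LocDomainZ4`) with FROZEN, k-, history- and coupling-free SUMMABLE majorants `|I X| ≤ M X` ([II] Lemma 3 (2.38) p. 20 +
tree sum + cube sum, tree `RemainderChain` (L1)–(L3)).  EDITION 3 READING OF `b` (CRIT-2 ROUND 2 «make `N_k` explicit; is it history-free?»): the history-FREE part `N_k` of the structural
split `β_k(hist) = N_k + Σ_X I_X(k, hist)` IS the parameter `b` — a bare sequence `ℕ → ℝ`, history-free BY TYPE; at the record it is INSTANTIATED by the anchored corner sequence the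
registered 2ᶜᴰ hands over (unique, `ScaleAnchor.eq`), so no identification letter is left on the card's side (V2 dissolved: the seam's anchor is the identification). [cite: Balaban1988RG2Cluster, Lemma 3 (2.38) p.20; Balaban1987RG1, (2.13) p.268] -/
structure ActivityRepr (β : HBeta) (b : ℕ → ℝ) (γ₀ : ℝ) where
  /-- the X-localized term of the remainder at scale k as a function of the history `(g_0,…,g_k)` -/
  I : LocDomainZ4 → (k : ℕ) → (Fin (k + 1) → ℝ) → ℝ
  /-- the frozen majorant of the X-term -/
  M : LocDomainZ4 → ℝ
  M_nonneg : ∀ X, 0 ≤ M X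
  M_summable : Summable M
  hasSum_run : ∀ (n : ℕ) (gs : ℕ → ℝ), RGEqH n β gs → Step.InInterval γ₀ n gs → ∀ k, k ≤ n →
    HasSum (fun X => I X k (prefixOf gs k)) (β k (prefixOf gs k) - b k)
  frozen_run : ∀ (n : ℕ) (gs : ℕ → ℝ), RGEqH n β gs → Step.InInterval γ₀ n gs → ∀ k, k ≤ n →
    ∀ X, |I X k (prefixOf gs k)| ≤ M X

/-- **S-LIN `LinOnRuns R` (hypothesis shape ABOUT A GIVEN representation; VERBATIM Sketch2 :246)** — every term vanishes LINEARLY in the running coupling, `|I X k (g_0,…,g_k)| ≤ A X · g_k`,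
with per-domain constants `A X` that are k- and history-free but carry NO decay and NO summability in `X`. [cite: Balaban1987RG1, (2.13) p.268; Balaban1988RG2Cluster, p.8] -/
def LinOnRuns {β : HBeta} {b : ℕ → ℝ} {γ₀ : ℝ} (R : ActivityRepr β b γ₀) : Prop :=
  ∃ A : LocDomainZ4 → ℝ, (∀ X, 0 ≤ A X) ∧
    ∀ (n : ℕ) (gs : ℕ → ℝ), RGEqH n β gs → Step.InInterval γ₀ n gs → ∀ k, k ≤ n →
      ∀ X, |R.I X k (prefixOf gs k)| ≤ A X * gs k

/-- **S-LIN ⟹ the modulus letter (proved, Tannery; VERBATIM Sketch2 :260)** — on ANY pinned representation, `ω(g) = Σ'_X min(A X · g, M X)`; no rate, no `Σ A X`. [folklore] -/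
theorem runModulus_of_linOnRuns {β : HBeta} {b : ℕ → ℝ} {γ₀ : ℝ} (R : ActivityRepr β b γ₀) (h : LinOnRuns R) :
    RunModulus β b γ₀ := by
  obtain ⟨A, hA, hlin⟩ := h
  refine ⟨omegaMin A R.M, tendsto_omegaMin hA R.M_nonneg R.M_summable, ?_⟩
  intro n gs hrg hI k hk
  rw [← (R.hasSum_run n gs hrg hI k hk).tsum_eq]
  exact abs_tsum_le_omegaMin R.M_summable (fun X => R.frozen_run n gs hrg hI k hk X) (fun X => hlin n gs hrg hI k hk X)

/-- **`RecordReprCorner13` — THE TYPE of the definer-first deliverable D-REPR at the CORNER keying (edition 3; NOT constructed here).**  For every tuple under the crux prefix and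
EVERY anchored corner sequence `b` (`ScaleAnchor D.βfun b` — the registered texts' own antecedent, not a card hypothesis), a window `γ₀ b ≤ θ.γ` and an `ActivityRepr` of the record's
β against THAT `b`.  Replaces Sketch2's `RecordRepr13` (κ, `θ.cβ·beta0OfJs F κ`, `ScaleAnchor` at κ: all DELETED).  INTENDED INHABITANT unchanged: `I X k hist :=` the X-term of print's
localized β¹ through `secondMoment ∘ polLimit`, `M X :=` the `RemainderChain` constants ([I] (1.20)–(1.22), (2.12)–(2.15); [II] (2.13)). [cite: Balaban1987RG1, (1.22) p.264 and (2.13) p.268; Balaban1988RG2Cluster, (2.13) p.15] -/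
structure RecordReprCorner13 where
  /-- the window of the representation at a tuple and an anchored corner sequence -/
  γ₀ : (F : T4Family) → (θ : Node00.Stage13HParams F 2) → θ.Provisos₁₃SepCoPH F 2 → (ℕ → ℝ) → ℝ
  γ₀_pos : ∀ F θ hP b, 0 < γ₀ F θ hP b
  γ₀_le : ∀ F θ hP b, γ₀ F θ hP b ≤ θ.γ
  /-- the representation itself, available under the crux prefix, against any anchored corner sequence -/
  repr : ∀ (F : T4Family) (θ : Node00.Stage13HParams F 2) (hP : θ.Provisos₁₃SepCoPH F 2),
    (θ.ZhUnity F 2 ∧ θ.SlotsNondegenerate₁₃ F 2) → θ.Admissible F 2 →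
    B16.EndStatementBPrinted (Node00.datumOfRecord₁₃SepCoPH F 2 θ hP).C → Window13 F θ hP →
    ∀ b : ℕ → ℝ, ScaleAnchor (Node00.datumOfRecord₁₃SepCoPH F 2 θ hP).βfun b →
    ActivityRepr (Node00.datumOfRecord₁₃SepCoPH F 2 θ hP).βfun b (γ₀ F θ hP b)

/-- **S-LIN AT THE CORNER (hypothesis shape ABOUT a delivered `𝓡 : RecordReprCorner13`)** — every representation `𝓡` delivers obeys `LinOnRuns`.  The stub a line would register AFTER D-REPR
lands: `LinAtCorner13 activityReprOfRecord₁₃`; size L (the per-polymer cubic∕moment insertion with ONE marked factor; memo `DESK-CF1-two-bound-idea5g9.md` = its informal proof at |X| = 1). [cite: Balaban1987RG1, (2.13) p.268; Balaban1988RG2Cluster, p.8 and (1.38)–(1.40) p.10] -/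
def LinAtCorner13 (𝓡 : RecordReprCorner13) : Prop :=
  ∀ (F : T4Family) (θ : Node00.Stage13HParams F 2) (hP : θ.Provisos₁₃SepCoPH F 2)
    (hU : θ.ZhUnity F 2 ∧ θ.SlotsNondegenerate₁₃ F 2) (hθ : θ.Admissible F 2)
    (hB : B16.EndStatementBPrinted (Node00.datumOfRecord₁₃SepCoPH F 2 θ hP).C) (hwin : Window13 F θ hP)
    (b : ℕ → ℝ) (hanch : ScaleAnchor (Node00.datumOfRecord₁₃SepCoPH F 2 θ hP).βfun b),
    LinOnRuns (𝓡.repr F θ hP hU hθ hB hwin b hanch)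

/-- **(C) at SOME level (hypothesis shape; the survivor-continuity letter [I] §1 pp. 263–264, shared with every road, not this card's object)** — one level suffices by `survCont_anti`. [cite: Balaban1987RG1, Thm 3 p.264] -/
def SurvContSome13 : Prop :=
  ∀ (F : T4Family) (θ : Node00.Stage13HParams F 2) (hP : θ.Provisos₁₃SepCoPH F 2), (θ.ZhUnity F 2 ∧ θ.SlotsNondegenerate₁₃ F 2) → θ.Admissible F 2 →
    B16.EndStatementBPrinted (Node00.datumOfRecord₁₃SepCoPH F 2 θ hP).C → Window13 F θ hP →
    ∃ γ₁ : ℝ, 0 < γ₁ ∧ SurvCont (Node00.datumOfRecord₁₃SepCoPH F 2 θ hP).βfun γ₁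

/-- **S-LIN(𝓡) ∧ (C) ⟹ 1ᶜᴹ′ (proved)**: Tannery at the delivered representation on `]0, 𝓡.γ₀]`, both letters moved down to `min (𝓡.γ₀ b) γ₁` (`runModulus_mono`, `survCont_anti`). [folklore] -/
theorem runModulusAtCorner13_of_lin_survCont (𝓡 : RecordReprCorner13) (hL : LinAtCorner13 𝓡) (hC : SurvContSome13) : RunModulusAtCorner13 := by
  intro F θ hP hU hθ hB hwin b hanch
  obtain ⟨γ₁, hγ₁, hsc⟩ := hC F θ hP hU hθ hB hwin
  have hmod := runModulus_of_linOnRuns (𝓡.repr F θ hP hU hθ hB hwin b hanch) (hL F θ hP hU hθ hB hwin b hanch)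
  refine ⟨min (𝓡.γ₀ F θ hP b) γ₁, lt_min (𝓡.γ₀_pos F θ hP b) hγ₁, (min_le_left _ _).trans (𝓡.γ₀_le F θ hP b),
    runModulus_mono hmod (min_le_left _ _), survCont_anti (lt_min (𝓡.γ₀_pos F θ hP b) hγ₁) (min_le_right _ _) hsc⟩

/-- **★★★ THE CARD's WHOLE CHAIN AT THE v7 CORNER KEYING (proved, no sorry): 2ᶜᴰ ∧ S-LIN(𝓡) ∧ (C) ⟹ THE CRUX DECL BY NAME** — S-LIN ⟹ 1ᶜᴹ′ (Tannery) ⟹ 1ᶜᴹ ⟹ 1ᶜᶜ (window pays the cap) ⟹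
with 2ᶜᴰ the crux (tree END).  CONDITIONAL on the displayed hypothesis texts and on a delivered `𝓡` (D-REPR, definer-first, the dominant debt); nothing of Bałaban asserted; K2⁷ NOT
closed. [cite: Balaban1987RG1, Thm 2 p.259 (first sentence) and (2.13) p.268; Balaban1988RG2Cluster, Lemma 3 (2.38) p.20] -/
theorem EndpointGivenBR13SepCoPH_of_cornerDrift_lin_survCont (𝓡 : RecordReprCorner13) (h₁ : CornerDriftPos13) (hL : LinAtCorner13 𝓡) (hC : SurvContSome13) :
    Summit.QuantumFields.YangMills.Theses.BalabanUVNodes.EndpointGivenBR13SepCoPH :=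
  EndpointGivenBR13SepCoPH_of_cornerDrift_runModulusAtCorner h₁ (runModulusAtCorner13_of_lin_survCont 𝓡 hL hC)

/-! ## §5 The BOX edition of the lever (edition 3; answers DEF-1 g6's located point bus l.30702 (i) «`ScaleAnchor` ⟹ base-line face is NOT a kernel fact» and plan g84 (3)):
S-LIN on the whole HISTORY BOX — `|I_X(k, p)| ≤ A_X · p_k` for every `p ∈ ]0, γ₀]^{k+1}`, not only along runs — is print's «the expression under the exponential vanishes at
g_k = 0» FOR ALL EARLIER HISTORIES ([I] (2.13)–(2.14) p. 268), and by Tannery it yields a BOX MODULUS `|β_k(p) − N_k| ≤ ω(p_k)`, hence the corner limit ITSELF: `ScaleAnchor β N`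
for the representation's own history-free part `N`.  So at the corner keying the card's lever, box-wise, pays the EXISTENCE conjunct of 2ᶜᴰ and the modulus 1ᶜᴹ′ at once and for
the SAME `N` (no identification letter anywhere); what stays outside the card is the drift SIGN `0 < s ∧ OneLoopDrift s A N` ((D1) at print's numbers), (C), and D-REPR. -/

/-- **`BoxModulus β b γ₀` — the modulus letter on the whole history box**: `|β_k(p) − b_k| ≤ ω(p_k)` for every `p ∈ HistBox γ₀ k`, `ω → 0` at `0⁺`; history-UNIFORM (the earlier
couplings are free in `]0, γ₀]`). Hypothesis shape, never a fact. [cite: Balaban1987RG1, (2.13)–(2.14) p.268] -/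
def BoxModulus (β : HBeta) (b : ℕ → ℝ) (γ₀ : ℝ) : Prop :=
  ∃ ω : ℝ → ℝ, Tendsto ω (𝓝[>] 0) (𝓝 0) ∧ ∀ (k : ℕ) (p : Fin (k + 1) → ℝ), p ∈ HistBox γ₀ k → |β k p - b k| ≤ ω (p (Fin.last k))

/-- A run's coupling prefix lies in the history box of the run's window. [folklore] -/
theorem prefixOf_mem_histBox {γ₀ : ℝ} {n : ℕ} {gs : ℕ → ℝ} (hI : Step.InInterval γ₀ n gs) {k : ℕ} (hk : k ≤ n) : prefixOf gs k ∈ HistBox γ₀ k :=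
  fun i => hI i ((Nat.le_of_lt_succ i.isLt).trans hk)

/-- **BOX ⟹ RUN**: a box modulus is in particular a run modulus on the same window (run prefixes are box points, `p_k = g_k`). [folklore] -/
theorem runModulus_of_boxModulus {β : HBeta} {b : ℕ → ℝ} {γ₀ : ℝ} (h : BoxModulus β b γ₀) : RunModulus β b γ₀ := by
  obtain ⟨ω, hω, hbox⟩ := h
  exact ⟨ω, hω, fun n gs _ hI k hk => hbox k (prefixOf gs k) (prefixOf_mem_histBox hI hk)⟩

/-- **BOX MODULUS ⟹ THE CORNER LIMIT (proved)**: `BoxModulus β b γ₀` with `0 < γ₀` gives `ScaleAnchor β b` — for `δ > 0` take the box of side `min γ₀ (u∕2)` where `ω < δ` on `]0, u[`.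
This is the kernel form of «β¹ vanishes at g_k = 0 for all earlier histories ⟹ the corner limit exists and equals the one-loop number» ([I] (2.13) p. 268). [cite: Balaban1987RG1, (2.13) p.268] -/
theorem scaleAnchor_of_boxModulus {β : HBeta} {b : ℕ → ℝ} {γ₀ : ℝ} (h : BoxModulus β b γ₀) (hγ₀ : 0 < γ₀) : ScaleAnchor β b := by
  obtain ⟨ω, hω, hbox⟩ := h
  intro k δ hδ
  have hev : ∀ᶠ g in 𝓝[>] (0 : ℝ), ω g < δ := (tendsto_order.1 hω).2 δ hδ
  obtain ⟨u, hu, hsub⟩ := mem_nhdsGT_iff_exists_Ioo_subset.1 hev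
  have hu0 : (0 : ℝ) < u := hu
  refine ⟨min γ₀ (u / 2), lt_min hγ₀ (half_pos hu0), fun p hp => ?_⟩
  have hp₀ : p ∈ HistBox γ₀ k := fun i => ⟨(hp i).1, (hp i).2.trans (min_le_left _ _)⟩
  have hmem : p (Fin.last k) ∈ Set.Ioo 0 u :=
    ⟨(hp _).1, lt_of_le_of_lt ((hp _).2.trans (min_le_right _ _)) (half_lt_self hu0)⟩
  exact (hbox k p hp₀).trans (hsub hmem).le

/-- **`BoxActivityRepr β b γ₀` — the pinned activity representation on the whole history box** (D-REPR's fibre, BOX edition): `β_k(p) − b_k = Σ_X I X k p` with frozen summable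
majorants for EVERY `p ∈ HistBox γ₀ k` — what print's (2.13) + [II] Lemma 3 give (the expansion holds for all small-field histories, not only along RG runs). Interface; NOT constructed
here. [cite: Balaban1988RG2Cluster, Lemma 3 (2.38) p.20; Balaban1987RG1, (2.13) p.268] -/
structure BoxActivityRepr (β : HBeta) (b : ℕ → ℝ) (γ₀ : ℝ) where
  /-- the X-localized term of the remainder at scale k as a function of the history -/
  I : LocDomainZ4 → (k : ℕ) → (Fin (k + 1) → ℝ) → ℝ
  /-- the frozen majorant of the X-term -/
  M : LocDomainZ4 → ℝ
  M_nonneg : ∀ X, 0 ≤ M X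
  M_summable : Summable M
  hasSum_box : ∀ (k : ℕ) (p : Fin (k + 1) → ℝ), p ∈ HistBox γ₀ k → HasSum (fun X => I X k p) (β k p - b k)
  frozen_box : ∀ (k : ℕ) (p : Fin (k + 1) → ℝ), p ∈ HistBox γ₀ k → ∀ X, |I X k p| ≤ M X

/-- **S-LIN-BOX `LinOnBox R`** — every term vanishes linearly in the LAST coupling, uniformly in the earlier ones: `|I X k p| ≤ A X · p_k` on the box; `A X` k- and history-free, NO
decay, NO summability in `X` (print's «use g_k|B| instead of ε₁», [II] p. 8, done once per polymer). Hypothesis shape ABOUT a given representation. [cite: Balaban1988RG2Cluster, p.8 and (1.38)–(1.40) p.10] -/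
def LinOnBox {β : HBeta} {b : ℕ → ℝ} {γ₀ : ℝ} (R : BoxActivityRepr β b γ₀) : Prop :=
  ∃ A : LocDomainZ4 → ℝ, (∀ X, 0 ≤ A X) ∧ ∀ (k : ℕ) (p : Fin (k + 1) → ℝ), p ∈ HistBox γ₀ k → ∀ X, |R.I X k p| ≤ A X * p (Fin.last k)

/-- **S-LIN-BOX ⟹ BOX MODULUS (proved, Tannery)**, `ω(g) = Σ'_X min(A X · g, M X)`. [folklore] -/
theorem boxModulus_of_linOnBox {β : HBeta} {b : ℕ → ℝ} {γ₀ : ℝ} (R : BoxActivityRepr β b γ₀) (h : LinOnBox R) : BoxModulus β b γ₀ := by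
  obtain ⟨A, hA, hlin⟩ := h
  refine ⟨omegaMin A R.M, tendsto_omegaMin hA R.M_nonneg R.M_summable, ?_⟩
  intro k p hp
  rw [← (R.hasSum_box k p hp).tsum_eq]
  exact abs_tsum_le_omegaMin R.M_summable (fun X => R.frozen_box k p hp X) (fun X => hlin k p hp X)

/-- **★ S-LIN-BOX ⟹ THE CORNER LIMIT EXISTS AND IS THE REPRESENTATION's OWN `b` (proved)** — the EXISTENCE conjunct of 2ᶜᴰ for `b`, supplied by the card's lever box-wise; by
`ScaleAnchor.eq` every other anchored sequence equals this `b` (so the `∀ b, ScaleAnchor … →` antecedent of 1ᶜᴿ∕1ᶜᴹ ranges over ONE sequence). [cite: Balaban1987RG1, (2.13) p.268] -/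
theorem scaleAnchor_of_linOnBox {β : HBeta} {b : ℕ → ℝ} {γ₀ : ℝ} (R : BoxActivityRepr β b γ₀) (h : LinOnBox R) (hγ₀ : 0 < γ₀) : ScaleAnchor β b :=
  scaleAnchor_of_boxModulus (boxModulus_of_linOnBox R h) hγ₀

/-- The box representation restricts to runs (forgetting the off-run histories). [folklore] -/
def BoxActivityRepr.toRun {β : HBeta} {b : ℕ → ℝ} {γ₀ : ℝ} (R : BoxActivityRepr β b γ₀) : ActivityRepr β b γ₀ where
  I := R.I
  M := R.M
  M_nonneg := R.M_nonneg
  M_summable := R.M_summable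
  hasSum_run := fun _ gs _ hI k hk => R.hasSum_box k (prefixOf gs k) (prefixOf_mem_histBox hI hk)
  frozen_run := fun _ gs _ hI k hk => R.frozen_box k (prefixOf gs k) (prefixOf_mem_histBox hI hk)

/-- S-LIN-BOX restricts to S-LIN on runs. [folklore] -/
theorem linOnRuns_of_linOnBox {β : HBeta} {b : ℕ → ℝ} {γ₀ : ℝ} (R : BoxActivityRepr β b γ₀) (h : LinOnBox R) : LinOnRuns R.toRun := by
  obtain ⟨A, hA, hlin⟩ := h
  exact ⟨A, hA, fun n gs _ hI k hk X => hlin k (prefixOf gs k) (prefixOf_mem_histBox hI hk) X⟩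

/-- **`BoxRecordRepr13` — D-REPR's type, BOX edition, with the history-free part `N` a FIELD (no `∀ b`, no anchor antecedent, no κ).**  Per tuple under the crux prefix: a sequence
`N F θ hP : ℕ → ℝ` (print's one-loop normalisation second moments `β⁰_{k+1}`, [I] (1.20)–(1.22) p. 264, [II] p. 21 L21–27 — g-INDEPENDENT by construction, hence history-free BY TYPE),
a window, and a `BoxActivityRepr` of the record's β against `N`.  NOT constructed here (definer-first, the dominant debt). [cite: Balaban1987RG1, (1.22) p.264 and (2.13) p.268; Balaban1988RG2Cluster, (2.13) p.15 and Lemma 3 (2.38) p.20] -/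
structure BoxRecordRepr13 where
  /-- the history-free part: print's one-loop numbers transported to the record -/
  N : (F : T4Family) → (θ : Node00.Stage13HParams F 2) → θ.Provisos₁₃SepCoPH F 2 → ℕ → ℝ
  /-- the window of the representation -/
  γ₀ : (F : T4Family) → (θ : Node00.Stage13HParams F 2) → θ.Provisos₁₃SepCoPH F 2 → ℝ
  γ₀_pos : ∀ F θ hP, 0 < γ₀ F θ hP
  γ₀_le : ∀ F θ hP, γ₀ F θ hP ≤ θ.γ
  repr : ∀ (F : T4Family) (θ : Node00.Stage13HParams F 2) (hP : θ.Provisos₁₃SepCoPH F 2),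
    (θ.ZhUnity F 2 ∧ θ.SlotsNondegenerate₁₃ F 2) → θ.Admissible F 2 →
    B16.EndStatementBPrinted (Node00.datumOfRecord₁₃SepCoPH F 2 θ hP).C → Window13 F θ hP →
    BoxActivityRepr (Node00.datumOfRecord₁₃SepCoPH F 2 θ hP).βfun (N F θ hP) (γ₀ F θ hP)

/-- **S-LIN-BOX AT THE RECORD (hypothesis shape about a delivered `𝓑 : BoxRecordRepr13`)** — the stub a line would register after D-REPR lands (size L: the per-polymer marked-factor
bound, history-uniform because print's bounds are uniform on the small-field analyticity space). [cite: Balaban1988RG2Cluster, (1.38)–(1.40) p.10 and p.11 L6–8] -/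
def LinOnBox13 (𝓑 : BoxRecordRepr13) : Prop :=
  ∀ (F : T4Family) (θ : Node00.Stage13HParams F 2) (hP : θ.Provisos₁₃SepCoPH F 2)
    (hU : θ.ZhUnity F 2 ∧ θ.SlotsNondegenerate₁₃ F 2) (hθ : θ.Admissible F 2)
    (hB : B16.EndStatementBPrinted (Node00.datumOfRecord₁₃SepCoPH F 2 θ hP).C) (hwin : Window13 F θ hP),
    LinOnBox (𝓑.repr F θ hP hU hθ hB hwin)

/-- **THE DRIFT SIGN AT THE REPRESENTATION's OWN NUMBERS (hypothesis shape; (D1) content — asymptotic freedom `b₀ > 0` of print's one-loop numbers; NOT this card's object).** [cite: Balaban1987RG1, Thm 2 p.259 and (1.22) p.264] -/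
def DriftAtN13 (𝓑 : BoxRecordRepr13) : Prop :=
  ∀ (F : T4Family) (θ : Node00.Stage13HParams F 2) (hP : θ.Provisos₁₃SepCoPH F 2), (θ.ZhUnity F 2 ∧ θ.SlotsNondegenerate₁₃ F 2) → θ.Admissible F 2 →
    B16.EndStatementBPrinted (Node00.datumOfRecord₁₃SepCoPH F 2 θ hP).C → Window13 F θ hP →
    ∃ s A : ℝ, 0 < s ∧ OneLoopDrift s A (𝓑.N F θ hP)

/-- **★ S-LIN-BOX(𝓑) ∧ drift-at-N ⟹ 2ᶜᴰ (proved)**: the existence conjunct comes from the lever (`scaleAnchor_of_linOnBox`), the sign from (D1). [folklore] -/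
theorem cornerDriftPos13_of_linOnBox_drift (𝓑 : BoxRecordRepr13) (hL : LinOnBox13 𝓑) (hD : DriftAtN13 𝓑) : CornerDriftPos13 := by
  intro F θ hP hU hθ hB hwin
  obtain ⟨s, A, hs, hd⟩ := hD F θ hP hU hθ hB hwin
  exact ⟨𝓑.N F θ hP, s, A, scaleAnchor_of_linOnBox (𝓑.repr F θ hP hU hθ hB hwin) (hL F θ hP hU hθ hB hwin) (𝓑.γ₀_pos F θ hP), hs, hd⟩

/-- **★ S-LIN-BOX(𝓑) ∧ (C) ⟹ 1ᶜᴹ′ (proved)**: for ANY anchored `b`, `b = 𝓑.N` by `ScaleAnchor.eq` against the lever's own anchor, then Tannery on runs. [folklore] -/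
theorem runModulusAtCorner13_of_linOnBox_survCont (𝓑 : BoxRecordRepr13) (hL : LinOnBox13 𝓑) (hC : SurvContSome13) : RunModulusAtCorner13 := by
  intro F θ hP hU hθ hB hwin b hanch
  have hLt := hL F θ hP hU hθ hB hwin
  have hbN : b = 𝓑.N F θ hP := hanch.eq (scaleAnchor_of_linOnBox (𝓑.repr F θ hP hU hθ hB hwin) hLt (𝓑.γ₀_pos F θ hP))
  subst hbN
  obtain ⟨γ₁, hγ₁, hsc⟩ := hC F θ hP hU hθ hB hwin
  have hmod : RunModulus (Node00.datumOfRecord₁₃SepCoPH F 2 θ hP).βfun (𝓑.N F θ hP) (𝓑.γ₀ F θ hP) :=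
    runModulus_of_boxModulus (boxModulus_of_linOnBox (𝓑.repr F θ hP hU hθ hB hwin) hLt)
  refine ⟨min (𝓑.γ₀ F θ hP) γ₁, lt_min (𝓑.γ₀_pos F θ hP) hγ₁, (min_le_left _ _).trans (𝓑.γ₀_le F θ hP),
    runModulus_mono hmod (min_le_left _ _), survCont_anti (lt_min (𝓑.γ₀_pos F θ hP) hγ₁) (min_le_right _ _) hsc⟩

/-- **★★★★ THE BOX EDITION's WHOLE CHAIN (proved, no sorry): S-LIN-BOX(𝓑) ∧ drift-at-N ∧ (C) ⟹ THE CRUX DECL BY NAME** — the lever pays BOTH the existence half of 2ᶜᴰ and the modulus;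
outside the card remain exactly: D-REPR (`𝓑` itself, definer-first), the drift SIGN at print's one-loop numbers ((D1)), and (C).  CONDITIONAL; nothing of Bałaban asserted; K2⁷ NOT closed;
R4 = the conditional finite-𝕋⁴ rung only; Clay NOT proved. [cite: Balaban1987RG1, Thm 2 p.259 (first sentence) and (2.13) p.268; Balaban1988RG2Cluster, Lemma 3 (2.38) p.20] -/
theorem EndpointGivenBR13SepCoPH_of_linOnBox_drift_survCont (𝓑 : BoxRecordRepr13) (hL : LinOnBox13 𝓑) (hD : DriftAtN13 𝓑) (hC : SurvContSome13) :
    Summit.QuantumFields.YangMills.Theses.BalabanUVNodes.EndpointGivenBR13SepCoPH :=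
  EndpointGivenBR13SepCoPH_of_cornerDrift_runModulusAtCorner (cornerDriftPos13_of_linOnBox_drift 𝓑 hL hD)
    (runModulusAtCorner13_of_linOnBox_survCont 𝓑 hL hC)

end Summit.QuantumFields.YangMills.Cruxes.EndpointGivenBR13SepCoPH.Idea5g10

end
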